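import Literature.Probability.LatticeModels.TripleTruncation
import Literature.Probability.LatticeModels.CouplingPathCalculus
import HarnessLib

/-!
# The summed form of Aizenman–Fernández's Proposition 5.2

Topic `Probability/LatticeModels`, namespace `Literature.Probability.LatticeModels`. For a `θ'`-system
with nonnegative couplings dominated by `θ`, a uniform ghost coupling `h̃ > 0` and magnetisations
at most `M` (with `h̃ ≤ 2M`), and two distinct bonds `b = {u,v}`, `b' = {k,l}` of `Λ`,

`∑_{y ∈ Λ} ⟨σ_y; σ_uσ_v; σ_kσ_l⟩_{θ'} ≤ 10 (M²/h̃) ∑_{w ∈ b, w' ∈ b'} ⟨σ_wσ_{w'}⟩_{θ, h=0}`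

(`sum_tripleTrunc_le`). This is the "summed version" of Prop. 5.2 used in (5.50)–(5.51): the
pointwise bound (5.4) (`tripleTrunc_le`) for `y ∉ b ∪ b'`, the GHS susceptibility bound
`∑_y ⟨σ_y;σ_a⟩_{θ'} ≤ ⟨σ_a⟩_{θ'}/h̃` (the tree's weak GHS inequality `thetaCorr_sum_field_trunc_le` of
`CouplingPathCalculus`, replacing the printed use of (4.22)/(4.26):
"an upper bound for the truncated correlation `⟨σ_y;σ_u⟩` that is monotone in `s₂`"), Griffiths II
for the remaining factors, and direct Griffiths-II bounds for the coincident sites `y ∈ b ∪ b'`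
and for adjacent bonds (where one of the factors `⟨σ_wσ_{w'}⟩_{h=0}` is `⟨σ_vσ_v⟩ = 1`).

Everything is proved; there are no named facts.

## References

* M. Aizenman, R. Fernández, J. Stat. Phys. 44 (1986) 393–454: Prop. 5.2 (5.4)–(5.5) and the
  estimate (5.50)–(5.51) [AizenmanFernandezJSP1986].
* R. Fernández, J. Fröhlich, A. D. Sokal, Springer 1992, §12.5 (only a summed version exists)
  [FernandezFrohlichSokalSpringer1992].
-/

noncomputable section

open Finset
open scoped symmDiff

namespace Literature.Probability.LatticeModels

variable {V : Type*} [DecidableEq V]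

section Summed

variable {G : SimpleGraph V} [G.LocallyFinite] {Λ : Finset V}

local notation "Λg" => Finset.insertNone Λ

/-! ### Small Griffiths-II lemmas -/

/-- `tripleTrunc` is symmetric in the two bonds. [folklore] -/
theorem tripleTrunc_comm (θ : Sym2 (Option V) → ℝ) (x : V) (B C : Finset V) :
    tripleTrunc G Λ θ x B C = tripleTrunc G Λ θ x C B := by
  unfold tripleTrunc; rw [symmDiff_comm B C]; ring

/-- **(3.16) with magnetisation bounds**: for distinct `y, u, l ∈ Λ` and `θ ≥ 0`,
`⟨σ_yσ_uσ_l⟩ - ⟨σ_y⟩⟨σ_uσ_l⟩ ≤ ⟨σ_l⟩⟨σ_y;σ_u⟩ + ⟨σ_u⟩⟨σ_y;σ_l⟩` (Griffiths II on the depleted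
magnetisations in (3.16), then (3.15)). [cite: AizenmanFernandezJSP1986, §3.4, Cor. 3.5, eqs. (3.15)–(3.16)] -/
theorem thetaCorr_triple_sub_mul_le_trunc {θ : Sym2 (Option V) → ℝ} (hθ : ∀ e, 0 ≤ θ e) {y u l : V}
    (hy : y ∈ Λ) (hu : u ∈ Λ) (hl : l ∈ Λ) (hul : u ≠ l) :
    thetaCorr G Λ θ ({y} ∆ ({u} ∆ {l})) - thetaCorr G Λ θ {y} * thetaCorr G Λ θ ({u} ∆ {l}) ≤
      thetaCorr G Λ θ {l} * (thetaCorr G Λ θ ({y} ∆ {u}) - thetaCorr G Λ θ {y} * thetaCorr G Λ θ {u}) +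
        thetaCorr G Λ θ {u} * (thetaCorr G Λ θ ({y} ∆ {l}) - thetaCorr G Λ θ {y} * thetaCorr G Λ θ {l}) := by
  rw [thetaCorr_triple_sub_eq_sum hθ hy hu hl hul, thetaCorr_pair_sub_eq_sum_clusterWeight hθ hy hu,
    thetaCorr_pair_sub_eq_sum_clusterWeight hθ hy hl, mul_sum, mul_sum]
  have hA : ∀ {a b : V}, b ∈ Λ →
      ∑ S ∈ (Λg).powerset.filter (Claim1Side y a b), corrIn G Λ θ S {b} * clusterWeight G Λ θ y a S ≤
        ∑ S ∈ (Λg).powerset.filter (fun S => (none : Option V) ∈ S), thetaCorr G Λ θ {b} * clusterWeight G Λ θ y a S := by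
    intro a b hb
    calc _ ≤ ∑ S ∈ (Λg).powerset.filter (Claim1Side y a b), thetaCorr G Λ θ {b} * clusterWeight G Λ θ y a S :=
          sum_le_sum fun S _ => mul_le_mul_of_nonneg_right (corrIn_le_thetaCorr hθ S (singleton_subset_iff.2 hb))
            (clusterWeight_nonneg θ y a S)
      _ ≤ _ := by
          refine sum_le_sum_of_subset_of_nonneg (fun S hS => ?_) fun S _ _ =>
            mul_nonneg (thetaCorr_nonneg hθ (singleton_subset_iff.2 hb)) (clusterWeight_nonneg θ y a S)
          rw [mem_filter] at hS ⊢
          exact ⟨hS.1, hS.2.1⟩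
  exact add_le_add (hA hl) (hA hu)

/-- The truncation `⟨σ_xσ_A⟩ - ⟨σ_x⟩⟨σ_A⟩` is nonnegative (Griffiths II). [cite: FriedliVelenik2017, Thm. 3.49 (GKS II)] -/
theorem thetaCorr_mul_le_symmDiff' {θ : Sym2 (Option V) → ℝ} (hθ : ∀ e, 0 ≤ θ e) {x : V} (hx : x ∈ Λ)
    {A : Finset V} (hA : A ⊆ Λ) : 0 ≤ thetaCorr G Λ θ ({x} ∆ A) - thetaCorr G Λ θ {x} * thetaCorr G Λ θ A := by
  have := thetaCorr_mul_le_symmDiff hθ (singleton_subset_iff.2 hx) hA (θ := θ) (G := G)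
  linarith

/-- `zeroField` is monotone in the couplings. [folklore] -/
theorem zeroField_mono {θ θ' : Sym2 (Option V) → ℝ} (hle : ∀ e, θ' e ≤ θ e) : ∀ e, zeroField θ' e ≤ zeroField θ e := by
  intro e; unfold zeroField; split_ifs; exacts [le_rfl, hle e]

/-! ### The setting: a dominated system with uniform field and magnetisation bound -/

/-- The hypotheses shared by the summed bounds: `0 ≤ θ' ≤ θ`, a uniform ghost coupling `h̃ > 0` in
`θ'`, the magnetisations of `θ` at most `M`, and `h̃ ≤ 2M`. [cite: AizenmanFernandezJSP1986, §5.3, the setting of (5.50)–(5.51)] -/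
structure DomSetting (G : SimpleGraph V) [G.LocallyFinite] (Λ : Finset V) (θ θ' : Sym2 (Option V) → ℝ) (hf M : ℝ) : Prop where
  nonneg : ∀ e, 0 ≤ θ e
  nonneg' : ∀ e, 0 ≤ θ' e
  le : ∀ e, θ' e ≤ θ e
  field_pos : 0 < hf
  field_eq : ∀ k ∈ Λ, θ' (ghostEdge k) = hf
  mag_le : ∀ v ∈ Λ, thetaCorr G Λ θ {v} ≤ M
  field_le : hf ≤ 2 * M

namespace DomSetting

variable {θ θ' : Sym2 (Option V) → ℝ} {hf M : ℝ} (H : DomSetting G Λ θ θ' hf M)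
include H

/-- `M > 0`. [folklore] -/
theorem M_pos : 0 < M := by linarith [H.field_pos, H.field_le]

/-- `⟨σ_v⟩_{θ'} ≤ M`. [folklore] -/
theorem mag'_le {v : V} (hv : v ∈ Λ) : thetaCorr G Λ θ' {v} ≤ M :=
  (thetaCorr_mono H.nonneg' H.le (singleton_subset_iff.2 hv)).trans (H.mag_le v hv)

/-- `0 ≤ ⟨σ_v⟩_{θ'}`. [folklore] -/
theorem mag'_nonneg {v : V} (hv : v ∈ Λ) : 0 ≤ thetaCorr G Λ θ' {v} := thetaCorr_nonneg H.nonneg' (singleton_subset_iff.2 hv)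

/-- `⟨σ_pσ_q⟩_{θ',h=0} ≤ ⟨σ_pσ_q⟩_{θ,h=0}`. [folklore] -/
theorem G'_le {p q : V} (hp : p ∈ Λ) (hq : q ∈ Λ) :
    thetaCorr G Λ (zeroField θ') ({p} ∆ {q}) ≤ thetaCorr G Λ (zeroField θ) ({p} ∆ {q}) :=
  thetaCorr_mono (zeroField_nonneg H.nonneg') (zeroField_mono H.le)
    (symmDiff_le_sup.trans (sup_le (singleton_subset_iff.2 hp) (singleton_subset_iff.2 hq)))

/-- `0 ≤ ⟨σ_pσ_q⟩_{h=0}`. [folklore] -/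
theorem G_nonneg {p q : V} (hp : p ∈ Λ) (hq : q ∈ Λ) : 0 ≤ thetaCorr G Λ (zeroField θ) ({p} ∆ {q}) :=
  thetaCorr_nonneg (zeroField_nonneg H.nonneg) (symmDiff_le_sup.trans (sup_le (singleton_subset_iff.2 hp) (singleton_subset_iff.2 hq)))

/-- `0 ≤ ⟨σ_pσ_q⟩_{θ',h=0}`. [folklore] -/
theorem G'_nonneg {p q : V} (hp : p ∈ Λ) (hq : q ∈ Λ) : 0 ≤ thetaCorr G Λ (zeroField θ') ({p} ∆ {q}) :=
  thetaCorr_nonneg (zeroField_nonneg H.nonneg') (symmDiff_le_sup.trans (sup_le (singleton_subset_iff.2 hp) (singleton_subset_iff.2 hq)))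

/-- `⟨σ_y;σ_a⟩_{θ'} ≥ 0`. [folklore] -/
theorem trunc'_nonneg {y a : V} (hy : y ∈ Λ) (ha : a ∈ Λ) :
    0 ≤ thetaCorr G Λ θ' ({y} ∆ {a}) - thetaCorr G Λ θ' {y} * thetaCorr G Λ θ' {a} :=
  thetaCorr_mul_le_symmDiff' H.nonneg' hy (singleton_subset_iff.2 ha)

/-- `⟨σ_y;σ_a⟩_{θ'} ≤ ⟨σ_yσ_a⟩_{θ,h=0}` (GHS domination, then monotonicity). [cite: AizenmanFernandezJSP1986, §4.3, Prop. 4.7, eq. (4.22)] -/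
theorem trunc'_le_G {y a : V} (hy : y ∈ Λ) (ha : a ∈ Λ) :
    thetaCorr G Λ θ' ({y} ∆ {a}) - thetaCorr G Λ θ' {y} * thetaCorr G Λ θ' {a} ≤ thetaCorr G Λ (zeroField θ) ({y} ∆ {a}) :=
  (thetaCorr_pair_sub_mul_le_zeroField H.nonneg' hy ha).trans (H.G'_le hy ha)

/-- **The summed GHS bound**: `∑_y ⟨σ_y;σ_a⟩_{θ'} ≤ M/h̃`. [cite: FernandezFrohlichSokalSpringer1992, eq. (12.163), p. 262] -/
theorem sum_trunc'_le {a : V} (ha : a ∈ Λ) :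
    ∑ y ∈ Λ, (thetaCorr G Λ θ' ({y} ∆ {a}) - thetaCorr G Λ θ' {y} * thetaCorr G Λ θ' {a}) ≤ M / hf := by
  -- the tree's weak GHS inequality `∑_z θ'_{z,g} ⟨σ_a;σ_z⟩ ≤ ⟨σ_a⟩` with the uniform field `θ'_{z,g} = h̃`
  have h := thetaCorr_sum_field_trunc_le (G := G) (Λ := Λ) H.nonneg' ha
  have h' : hf * ∑ y ∈ Λ, (thetaCorr G Λ θ' ({y} ∆ {a}) - thetaCorr G Λ θ' {y} * thetaCorr G Λ θ' {a}) ≤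
      thetaCorr G Λ θ' {a} := by
    rw [mul_sum]
    calc _ = ∑ z ∈ Λ, θ' (ghostEdge z) * (thetaCorr G Λ θ' ({a} ∆ {z}) - thetaCorr G Λ θ' {a} * thetaCorr G Λ θ' {z}) :=
          sum_congr rfl fun z hz => by rw [H.field_eq z hz, symmDiff_comm, mul_comm (thetaCorr G Λ θ' {z})]
      _ ≤ _ := h
  rw [le_div_iff₀ H.field_pos, mul_comm]
  exact h'.trans (H.mag'_le ha)

/-- `M ≤ 2 M²/h̃`. [folklore] -/
theorem M_le : M ≤ 2 * (M ^ 2 / hf) := by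
  have h1 := H.M_pos
  have h2 := H.field_pos
  rw [mul_div_assoc', le_div_iff₀ h2]
  nlinarith [H.field_le, h1]

end DomSetting

/-! ### The coincident-site and adjacent-bond configurations (Griffiths II) -/

section Cases

variable {θ : Sym2 (Option V) → ℝ}

/-- `⟨σ_u; σ_uσ_v; σ_kσ_l⟩ ≤ ⟨σ_vσ_kσ_l⟩ - ⟨σ_v⟩⟨σ_kσ_l⟩` (`u, v, k, l` distinct): the two
subtracted products dominate `2⟨σ_u⟩⟨σ_uσ_v⟩⟨σ_kσ_l⟩` by Griffiths II. [cite: FriedliVelenik2017, Thm. 3.49 (GKS II)] -/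
theorem tripleTrunc_end_le (hθ : ∀ e, 0 ≤ θ e) {u v k l : V} (hu : u ∈ Λ) (hv : v ∈ Λ) (hk : k ∈ Λ) (hl : l ∈ Λ) :
    tripleTrunc G Λ θ u ({u} ∆ {v}) ({k} ∆ {l}) ≤
      thetaCorr G Λ θ ({v} ∆ ({k} ∆ {l})) - thetaCorr G Λ θ {v} * thetaCorr G Λ θ ({k} ∆ {l}) := by
  unfold tripleTrunc
  have e1 : ({u} ∆ ({u} ∆ {v}) : Finset V) = {v} := symmDiff_symmDiff_cancel_left _ _
  have e2 : ({u} ∆ (({u} ∆ {v}) ∆ ({k} ∆ {l})) : Finset V) = {v} ∆ ({k} ∆ {l}) := by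
    rw [symmDiff_assoc, symmDiff_symmDiff_cancel_left]
  rw [e1, e2]
  have hkl : ({k} ∆ {l} : Finset V) ⊆ Λ := symmDiff_le_sup.trans (sup_le (singleton_subset_iff.2 hk) (singleton_subset_iff.2 hl))
  have huvs : ({u} ∆ {v} : Finset V) ⊆ Λ := symmDiff_le_sup.trans (sup_le (singleton_subset_iff.2 hu) (singleton_subset_iff.2 hv))
  have h1 : thetaCorr G Λ θ {u} * thetaCorr G Λ θ ({k} ∆ {l}) ≤ thetaCorr G Λ θ ({u} ∆ ({k} ∆ {l})) :=
    thetaCorr_mul_le_symmDiff hθ (singleton_subset_iff.2 hu) hkl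
  have h2 : thetaCorr G Λ θ ({u} ∆ {v}) * thetaCorr G Λ θ ({k} ∆ {l}) ≤ thetaCorr G Λ θ (({u} ∆ {v}) ∆ ({k} ∆ {l})) :=
    thetaCorr_mul_le_symmDiff hθ huvs hkl
  have hB : 0 ≤ thetaCorr G Λ θ ({u} ∆ {v}) := thetaCorr_nonneg hθ huvs
  have hU : 0 ≤ thetaCorr G Λ θ {u} := thetaCorr_nonneg hθ (singleton_subset_iff.2 hu)
  nlinarith [mul_le_mul_of_nonneg_left h1 hB, mul_le_mul_of_nonneg_left h2 hU]

/-- Adjacent bonds `{u,v}`, `{v,l}`, observed at the outer vertex `u`: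
`⟨σ_u; σ_uσ_v; σ_vσ_l⟩ ≤ ⟨σ_l⟩`. [cite: FriedliVelenik2017, Thm. 3.49 (GKS II)] -/
theorem tripleTrunc_adj_end_le (hθ : ∀ e, 0 ≤ θ e) {u v l : V} (hu : u ∈ Λ) (hv : v ∈ Λ) (hl : l ∈ Λ) :
    tripleTrunc G Λ θ u ({u} ∆ {v}) ({v} ∆ {l}) ≤ thetaCorr G Λ θ {l} := by
  unfold tripleTrunc
  have e1 : ({u} ∆ ({u} ∆ {v}) : Finset V) = {v} := symmDiff_symmDiff_cancel_left _ _
  have e2 : (({u} ∆ {v}) ∆ ({v} ∆ {l}) : Finset V) = {u} ∆ {l} := by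
    rw [symmDiff_assoc, symmDiff_symmDiff_cancel_left]
  have e3 : ({u} ∆ ({u} ∆ {l}) : Finset V) = {l} := symmDiff_symmDiff_cancel_left _ _
  rw [e2, e1, e3]
  have hvl : ({v} ∆ {l} : Finset V) ⊆ Λ := symmDiff_le_sup.trans (sup_le (singleton_subset_iff.2 hv) (singleton_subset_iff.2 hl))
  have huv : ({u} ∆ {v} : Finset V) ⊆ Λ := symmDiff_le_sup.trans (sup_le (singleton_subset_iff.2 hu) (singleton_subset_iff.2 hv))
  have h1 : thetaCorr G Λ θ {u} * thetaCorr G Λ θ ({v} ∆ {l}) ≤ thetaCorr G Λ θ ({u} ∆ ({v} ∆ {l})) :=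
    thetaCorr_mul_le_symmDiff hθ (singleton_subset_iff.2 hu) hvl
  have h2 : thetaCorr G Λ θ ({u} ∆ {v}) * thetaCorr G Λ θ ({v} ∆ {l}) ≤ thetaCorr G Λ θ ({u} ∆ {l}) := by
    have := thetaCorr_mul_le_symmDiff hθ huv hvl (θ := θ) (G := G); rwa [e2] at this
  have hB : 0 ≤ thetaCorr G Λ θ ({u} ∆ {v}) := thetaCorr_nonneg hθ huv
  have hC : 0 ≤ thetaCorr G Λ θ ({v} ∆ {l}) := thetaCorr_nonneg hθ hvl
  have hU : 0 ≤ thetaCorr G Λ θ {u} := thetaCorr_nonneg hθ (singleton_subset_iff.2 hu)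
  have hV : 0 ≤ thetaCorr G Λ θ {v} := thetaCorr_nonneg hθ (singleton_subset_iff.2 hv)
  nlinarith [mul_le_mul_of_nonneg_left h1 hB, mul_le_mul_of_nonneg_left h2 hU, mul_nonneg hV hC]

/-- Adjacent bonds `{u,v}`, `{v,l}`, observed at the shared vertex `v`:
`⟨σ_v; σ_uσ_v; σ_vσ_l⟩ ≤ ⟨σ_vσ_uσ_l⟩ - ⟨σ_v⟩⟨σ_uσ_l⟩`. [cite: FriedliVelenik2017, Thm. 3.49 (GKS II)] -/
theorem tripleTrunc_adj_mid_le (hθ : ∀ e, 0 ≤ θ e) {u v l : V} (hu : u ∈ Λ) (hv : v ∈ Λ) (hl : l ∈ Λ) :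
    tripleTrunc G Λ θ v ({u} ∆ {v}) ({v} ∆ {l}) ≤
      thetaCorr G Λ θ ({v} ∆ ({u} ∆ {l})) - thetaCorr G Λ θ {v} * thetaCorr G Λ θ ({u} ∆ {l}) := by
  unfold tripleTrunc
  have e1 : ({v} ∆ ({u} ∆ {v}) : Finset V) = {u} := by
    rw [symmDiff_comm ({u} : Finset V) {v}, symmDiff_symmDiff_cancel_left]
  have e2 : (({u} ∆ {v}) ∆ ({v} ∆ {l}) : Finset V) = {u} ∆ {l} := by
    rw [symmDiff_assoc, symmDiff_symmDiff_cancel_left]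
  have e3 : ({v} ∆ ({v} ∆ {l}) : Finset V) = {l} := symmDiff_symmDiff_cancel_left _ _
  rw [e2, e1, e3]
  have hvl : ({v} ∆ {l} : Finset V) ⊆ Λ := symmDiff_le_sup.trans (sup_le (singleton_subset_iff.2 hv) (singleton_subset_iff.2 hl))
  have huv : ({u} ∆ {v} : Finset V) ⊆ Λ := symmDiff_le_sup.trans (sup_le (singleton_subset_iff.2 hu) (singleton_subset_iff.2 hv))
  have h1 : thetaCorr G Λ θ {v} * thetaCorr G Λ θ ({u} ∆ {v}) ≤ thetaCorr G Λ θ {u} := by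
    have := thetaCorr_mul_le_symmDiff hθ (singleton_subset_iff.2 hv) huv (θ := θ) (G := G); rwa [e1] at this
  have h2 : thetaCorr G Λ θ {v} * thetaCorr G Λ θ ({v} ∆ {l}) ≤ thetaCorr G Λ θ {l} := by
    have := thetaCorr_mul_le_symmDiff hθ (singleton_subset_iff.2 hv) hvl (θ := θ) (G := G); rwa [e3] at this
  have hB : 0 ≤ thetaCorr G Λ θ ({u} ∆ {v}) := thetaCorr_nonneg hθ huv
  have hC : 0 ≤ thetaCorr G Λ θ ({v} ∆ {l}) := thetaCorr_nonneg hθ hvl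
  nlinarith [mul_le_mul_of_nonneg_left h1 hC, mul_le_mul_of_nonneg_left h2 hB]

/-- Adjacent bonds `{u,v}`, `{v,l}`, observed away from them (`y ∉ {u,v,l}`):
`⟨σ_y; σ_uσ_v; σ_vσ_l⟩ ≤ ⟨σ_yσ_uσ_l⟩ - ⟨σ_y⟩⟨σ_uσ_l⟩` (the other two terms of the expansion are
`-⟨σ_vσ_l⟩⟨σ_y;σ_uσ_v⟩ - ⟨σ_uσ_v⟩⟨σ_y;σ_vσ_l⟩ ≤ 0`). [cite: FriedliVelenik2017, Thm. 3.49 (GKS II)] -/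
theorem tripleTrunc_adj_gen_le (hθ : ∀ e, 0 ≤ θ e) {y u v l : V} (hy : y ∈ Λ) (hu : u ∈ Λ) (hv : v ∈ Λ) (hl : l ∈ Λ) :
    tripleTrunc G Λ θ y ({u} ∆ {v}) ({v} ∆ {l}) ≤
      thetaCorr G Λ θ ({y} ∆ ({u} ∆ {l})) - thetaCorr G Λ θ {y} * thetaCorr G Λ θ ({u} ∆ {l}) := by
  unfold tripleTrunc
  have e2 : (({u} ∆ {v}) ∆ ({v} ∆ {l}) : Finset V) = {u} ∆ {l} := by
    rw [symmDiff_assoc, symmDiff_symmDiff_cancel_left]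
  rw [e2]
  have hvl : ({v} ∆ {l} : Finset V) ⊆ Λ := symmDiff_le_sup.trans (sup_le (singleton_subset_iff.2 hv) (singleton_subset_iff.2 hl))
  have huv : ({u} ∆ {v} : Finset V) ⊆ Λ := symmDiff_le_sup.trans (sup_le (singleton_subset_iff.2 hu) (singleton_subset_iff.2 hv))
  have h1 := thetaCorr_mul_le_symmDiff' hθ hy huv (θ := θ) (G := G)
  have h2 := thetaCorr_mul_le_symmDiff' hθ hy hvl (θ := θ) (G := G)
  have hB : 0 ≤ thetaCorr G Λ θ ({u} ∆ {v}) := thetaCorr_nonneg hθ huv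
  have hC : 0 ≤ thetaCorr G Λ θ ({v} ∆ {l}) := thetaCorr_nonneg hθ hvl
  nlinarith [mul_nonneg hC h1, mul_nonneg hB h2]

end Cases

/-! ### The summed bounds -/

section Sums

variable {θ θ' : Sym2 (Option V) → ℝ} {hf M : ℝ} (H : DomSetting G Λ θ θ' hf M)
include H

/-- **Disjoint bonds, generic sites**: for distinct `u, v, k, l ∈ Λ`,
`∑_{y ∉ {u,v,k,l}} ⟨σ_y; σ_uσ_v; σ_kσ_l⟩_{θ'} ≤ (4M²/h̃) (G_{uk} + G_{ul} + G_{vk} + G_{vl})`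
(Prop. 5.2 pointwise, the summed GHS bound for `∑_y ⟨σ_y;σ_a⟩`, Griffiths II for the other factors),
`G = ⟨σσ⟩_{θ,h=0}`. [cite: AizenmanFernandezJSP1986, §5.3, eqs. (5.50)–(5.51)] -/
theorem sum_tripleTrunc_sdiff_le {u v k l : V} (hu : u ∈ Λ) (hv : v ∈ Λ) (hk : k ∈ Λ) (hl : l ∈ Λ)
    (huv : u ≠ v) (huk : u ≠ k) (hul : u ≠ l) (hvk : v ≠ k) (hvl : v ≠ l) (hkl : k ≠ l) :
    ∑ y ∈ Λ \ {u, v, k, l}, tripleTrunc G Λ θ' y ({u} ∆ {v}) ({k} ∆ {l}) ≤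
      4 * (M ^ 2 / hf) * (thetaCorr G Λ (zeroField θ) ({u} ∆ {k}) + thetaCorr G Λ (zeroField θ) ({u} ∆ {l}) +
        thetaCorr G Λ (zeroField θ) ({v} ∆ {k}) + thetaCorr G Λ (zeroField θ) ({v} ∆ {l})) := by
  set τ : V → V → ℝ := fun y a => thetaCorr G Λ θ' ({y} ∆ {a}) - thetaCorr G Λ θ' {y} * thetaCorr G Λ θ' {a} with hτ
  set Gf : V → V → ℝ := fun p q => thetaCorr G Λ (zeroField θ) ({p} ∆ {q}) with hGf
  have hM0 := H.M_pos.le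
  have hGsym : ∀ p q : V, Gf p q = Gf q p := fun p q => by simp only [hGf]; rw [symmDiff_comm]
  -- pointwise bound for `y ∉ {u,v,k,l}`
  have hpt : ∀ y ∈ Λ \ {u, v, k, l}, tripleTrunc G Λ θ' y ({u} ∆ {v}) ({k} ∆ {l}) ≤
      2 * M * (τ y u * (Gf v k + Gf v l) + τ y v * (Gf u k + Gf u l) + τ y k * (Gf u l + Gf v l) + τ y l * (Gf u k + Gf v k)) := by
    intro y hy
    rw [mem_sdiff] at hy
    obtain ⟨hyΛ, hynot⟩ := hy
    simp only [mem_insert, mem_singleton, not_or] at hynot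
    obtain ⟨hyu, hyv, hyk, hyl⟩ := hynot
    have h := tripleTrunc_le (G := G) (Λ := Λ) H.nonneg' hyΛ hu hv hk hl hyu hyv hyk hyl huv huk hul hvk hvl hkl (θ := θ')
    refine h.trans ?_
    -- monotonicity of the factors
    have mu := H.mag'_le hu; have mv := H.mag'_le hv; have mk := H.mag'_le hk; have ml := H.mag'_le hl
    have gvk := H.G'_le hv hk; have gvl := H.G'_le hv hl; have guk := H.G'_le hu hk; have gul := H.G'_le hu hl
    have gly := H.G'_le hl hu; have glv := H.G'_le hl hv; have gku := H.G'_le hk hu; have gkv := H.G'_le hk hv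
    have t1 := H.trunc'_nonneg hyΛ hu; have t2 := H.trunc'_nonneg hyΛ hv; have t3 := H.trunc'_nonneg hyΛ hk; have t4 := H.trunc'_nonneg hyΛ hl
    have p1 : thetaCorr G Λ (zeroField θ') ({v} ∆ {k}) * thetaCorr G Λ θ' {l} ≤ Gf v k * M :=
      mul_le_mul gvk ml (H.mag'_nonneg hl) (H.G_nonneg hv hk)
    have p2 : thetaCorr G Λ (zeroField θ') ({v} ∆ {l}) * thetaCorr G Λ θ' {k} ≤ Gf v l * M :=
      mul_le_mul gvl mk (H.mag'_nonneg hk) (H.G_nonneg hv hl)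
    have p3 : thetaCorr G Λ (zeroField θ') ({u} ∆ {k}) * thetaCorr G Λ θ' {l} ≤ Gf u k * M :=
      mul_le_mul guk ml (H.mag'_nonneg hl) (H.G_nonneg hu hk)
    have p4 : thetaCorr G Λ (zeroField θ') ({u} ∆ {l}) * thetaCorr G Λ θ' {k} ≤ Gf u l * M :=
      mul_le_mul gul mk (H.mag'_nonneg hk) (H.G_nonneg hu hl)
    have p5 : thetaCorr G Λ (zeroField θ') ({l} ∆ {u}) * thetaCorr G Λ θ' {v} ≤ Gf u l * M := by
      rw [hGsym]; exact mul_le_mul gly mv (H.mag'_nonneg hv) (H.G_nonneg hl hu)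
    have p6 : thetaCorr G Λ (zeroField θ') ({l} ∆ {v}) * thetaCorr G Λ θ' {u} ≤ Gf v l * M := by
      rw [hGsym v l]; exact mul_le_mul glv mu (H.mag'_nonneg hu) (H.G_nonneg hl hv)
    have p7 : thetaCorr G Λ (zeroField θ') ({k} ∆ {u}) * thetaCorr G Λ θ' {v} ≤ Gf u k * M := by
      rw [hGsym]; exact mul_le_mul gku mv (H.mag'_nonneg hv) (H.G_nonneg hk hu)
    have p8 : thetaCorr G Λ (zeroField θ') ({k} ∆ {v}) * thetaCorr G Λ θ' {u} ≤ Gf v k * M := by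
      rw [hGsym v k]; exact mul_le_mul gkv mu (H.mag'_nonneg hu) (H.G_nonneg hk hv)
    have w1 := mul_le_mul_of_nonneg_left (add_le_add p1 p2) t1
    have w2 := mul_le_mul_of_nonneg_left (add_le_add p3 p4) t2
    have w3 := mul_le_mul_of_nonneg_left (add_le_add p5 p6) t3
    have w4 := mul_le_mul_of_nonneg_left (add_le_add p7 p8) t4
    simp only [hGf] at w1 w2 w3 w4 ⊢
    simp only [hτ]
    linear_combination 2 * w1 + 2 * w2 + 2 * w3 + 2 * w4
  refine (sum_le_sum hpt).trans ?_
  -- extend to all of `Λ` and use the summed GHS bound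
  have g1 := H.G_nonneg hv hk; have g2 := H.G_nonneg hv hl; have g3 := H.G_nonneg hu hk; have g4 := H.G_nonneg hu hl
  have hnn : ∀ y ∈ Λ, 0 ≤ 2 * M * (τ y u * (Gf v k + Gf v l) + τ y v * (Gf u k + Gf u l) + τ y k * (Gf u l + Gf v l) + τ y l * (Gf u k + Gf v k)) := by
    intro y hy
    have t1 := H.trunc'_nonneg hy hu; have t2 := H.trunc'_nonneg hy hv; have t3 := H.trunc'_nonneg hy hk; have t4 := H.trunc'_nonneg hy hl
    exact mul_nonneg (mul_nonneg two_pos.le hM0) (add_nonneg (add_nonneg (add_nonneg (mul_nonneg t1 (add_nonneg g1 g2))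
      (mul_nonneg t2 (add_nonneg g3 g4))) (mul_nonneg t3 (add_nonneg g4 g2))) (mul_nonneg t4 (add_nonneg g3 g1)))
  refine (sum_le_sum_of_subset_of_nonneg sdiff_subset fun y hy _ => hnn y hy).trans ?_
  have su := H.sum_trunc'_le hu; have sv := H.sum_trunc'_le hv; have sk := H.sum_trunc'_le hk; have sl := H.sum_trunc'_le hl
  rw [← mul_sum]
  simp only [sum_add_distrib, ← sum_mul]
  have hf0 := H.field_pos
  have q1 := mul_le_mul_of_nonneg_right su (add_nonneg g1 g2)
  have q2 := mul_le_mul_of_nonneg_right sv (add_nonneg g3 g4)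
  have q3 := mul_le_mul_of_nonneg_right sk (add_nonneg g4 g2)
  have q4 := mul_le_mul_of_nonneg_right sl (add_nonneg g3 g1)
  have key : 2 * M * (M / hf * (Gf v k + Gf v l) + M / hf * (Gf u k + Gf u l) + M / hf * (Gf u l + Gf v l) + M / hf * (Gf u k + Gf v k)) =
      4 * (M ^ 2 / hf) * (Gf u k + Gf u l + Gf v k + Gf v l) := by
    field_simp; ring
  simp only [hτ, hGf] at key q1 q2 q3 q4 ⊢
  rw [← key]
  refine mul_le_mul_of_nonneg_left ?_ (mul_nonneg two_pos.le hM0)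
  linear_combination q1 + q2 + q3 + q4

/-- **Disjoint bonds, coincident sites**: the four terms `y ∈ {u,v,k,l}` together are at most
`2M (G_{uk} + G_{ul} + G_{vk} + G_{vl})`. [cite: AizenmanFernandezJSP1986, §5.3, eqs. (5.50)–(5.51) (the coincident terms)] -/
theorem tripleTrunc_four_le {u v k l : V} (hu : u ∈ Λ) (hv : v ∈ Λ) (hk : k ∈ Λ) (hl : l ∈ Λ)
    (huv : u ≠ v) (hkl : k ≠ l) :
    tripleTrunc G Λ θ' u ({u} ∆ {v}) ({k} ∆ {l}) + tripleTrunc G Λ θ' v ({u} ∆ {v}) ({k} ∆ {l}) +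
        tripleTrunc G Λ θ' k ({u} ∆ {v}) ({k} ∆ {l}) + tripleTrunc G Λ θ' l ({u} ∆ {v}) ({k} ∆ {l}) ≤
      2 * M * (thetaCorr G Λ (zeroField θ) ({u} ∆ {k}) + thetaCorr G Λ (zeroField θ) ({u} ∆ {l}) +
        thetaCorr G Λ (zeroField θ) ({v} ∆ {k}) + thetaCorr G Λ (zeroField θ) ({v} ∆ {l})) := by
  have hθ' := H.nonneg'
  have hGsym : ∀ p q : V, thetaCorr G Λ (zeroField θ) ({p} ∆ {q}) = thetaCorr G Λ (zeroField θ) ({q} ∆ {p}) :=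
    fun p q => by rw [symmDiff_comm]
  -- `y = u`
  have h1 : tripleTrunc G Λ θ' u ({u} ∆ {v}) ({k} ∆ {l}) ≤ M * (thetaCorr G Λ (zeroField θ) ({v} ∆ {k}) + thetaCorr G Λ (zeroField θ) ({v} ∆ {l})) := by
    refine (tripleTrunc_end_le hθ' hu hv hk hl).trans ((thetaCorr_triple_sub_mul_le_trunc hθ' hv hk hl hkl).trans ?_)
    nlinarith [mul_le_mul (H.mag'_le hl) (H.trunc'_le_G hv hk) (H.trunc'_nonneg hv hk) H.M_pos.le,
      mul_le_mul (H.mag'_le hk) (H.trunc'_le_G hv hl) (H.trunc'_nonneg hv hl) H.M_pos.le]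
  -- `y = v`
  have h2 : tripleTrunc G Λ θ' v ({u} ∆ {v}) ({k} ∆ {l}) ≤ M * (thetaCorr G Λ (zeroField θ) ({u} ∆ {k}) + thetaCorr G Λ (zeroField θ) ({u} ∆ {l})) := by
    rw [symmDiff_comm ({u} : Finset V) {v}]
    refine (tripleTrunc_end_le hθ' hv hu hk hl).trans ((thetaCorr_triple_sub_mul_le_trunc hθ' hu hk hl hkl).trans ?_)
    nlinarith [mul_le_mul (H.mag'_le hl) (H.trunc'_le_G hu hk) (H.trunc'_nonneg hu hk) H.M_pos.le,
      mul_le_mul (H.mag'_le hk) (H.trunc'_le_G hu hl) (H.trunc'_nonneg hu hl) H.M_pos.le]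
  -- `y = k`
  have h3 : tripleTrunc G Λ θ' k ({u} ∆ {v}) ({k} ∆ {l}) ≤ M * (thetaCorr G Λ (zeroField θ) ({u} ∆ {l}) + thetaCorr G Λ (zeroField θ) ({v} ∆ {l})) := by
    rw [tripleTrunc_comm]
    refine (tripleTrunc_end_le hθ' hk hl hu hv).trans ((thetaCorr_triple_sub_mul_le_trunc hθ' hl hu hv huv).trans ?_)
    rw [hGsym u l, hGsym v l]
    nlinarith [mul_le_mul (H.mag'_le hv) (H.trunc'_le_G hl hu) (H.trunc'_nonneg hl hu) H.M_pos.le,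
      mul_le_mul (H.mag'_le hu) (H.trunc'_le_G hl hv) (H.trunc'_nonneg hl hv) H.M_pos.le]
  -- `y = l`
  have h4 : tripleTrunc G Λ θ' l ({u} ∆ {v}) ({k} ∆ {l}) ≤ M * (thetaCorr G Λ (zeroField θ) ({u} ∆ {k}) + thetaCorr G Λ (zeroField θ) ({v} ∆ {k})) := by
    rw [tripleTrunc_comm, symmDiff_comm ({k} : Finset V) {l}]
    refine (tripleTrunc_end_le hθ' hl hk hu hv).trans ((thetaCorr_triple_sub_mul_le_trunc hθ' hk hu hv huv).trans ?_)
    rw [hGsym u k, hGsym v k]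
    nlinarith [mul_le_mul (H.mag'_le hv) (H.trunc'_le_G hk hu) (H.trunc'_nonneg hk hu) H.M_pos.le,
      mul_le_mul (H.mag'_le hu) (H.trunc'_le_G hk hv) (H.trunc'_nonneg hk hv) H.M_pos.le]
  linarith [h1, h2, h3, h4]

/-- **Adjacent bonds**: `∑_{y ∈ Λ} ⟨σ_y; σ_uσ_v; σ_vσ_l⟩_{θ'} ≤ 10 M²/h̃` (`u, v, l` distinct): away from
the bonds the term is at most `⟨σ_l⟩⟨σ_y;σ_u⟩ + ⟨σ_u⟩⟨σ_y;σ_l⟩`, summed by GHS; at `u`, `l` it is at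
most a magnetisation, at `v` at most `2M`; and `M ≤ 2M²/h̃`. [cite: AizenmanFernandezJSP1986, §5.3, eqs. (5.50)–(5.51) (the coincident terms)] -/
theorem sum_tripleTrunc_adj_le {u v l : V} (hu : u ∈ Λ) (hv : v ∈ Λ) (hl : l ∈ Λ) (huv : u ≠ v) (hvl : v ≠ l) (hul : u ≠ l) :
    ∑ y ∈ Λ, tripleTrunc G Λ θ' y ({u} ∆ {v}) ({v} ∆ {l}) ≤ 10 * (M ^ 2 / hf) := by
  have hθ' := H.nonneg'
  set τ : V → V → ℝ := fun y a => thetaCorr G Λ θ' ({y} ∆ {a}) - thetaCorr G Λ θ' {y} * thetaCorr G Λ θ' {a} with hτ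
  have hS : ({u, v, l} : Finset V) ⊆ Λ := by
    intro w hw; simp only [mem_insert, mem_singleton] at hw
    rcases hw with rfl | rfl | rfl <;> assumption
  rw [← sum_sdiff hS]
  -- generic part
  have hgen : ∑ y ∈ Λ \ {u, v, l}, tripleTrunc G Λ θ' y ({u} ∆ {v}) ({v} ∆ {l}) ≤ 2 * (M ^ 2 / hf) := by
    have hpt : ∀ y ∈ Λ \ {u, v, l}, tripleTrunc G Λ θ' y ({u} ∆ {v}) ({v} ∆ {l}) ≤ M * (τ y u + τ y l) := by
      intro y hy
      rw [mem_sdiff] at hy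
      obtain ⟨hyΛ, hynot⟩ := hy
      simp only [mem_insert, mem_singleton, not_or] at hynot
      refine (tripleTrunc_adj_gen_le hθ' hyΛ hu hv hl).trans ((thetaCorr_triple_sub_mul_le_trunc hθ' hyΛ hu hl hul).trans ?_)
      simp only [hτ]
      nlinarith [mul_le_mul_of_nonneg_right (H.mag'_le hl) (H.trunc'_nonneg hyΛ hu),
        mul_le_mul_of_nonneg_right (H.mag'_le hu) (H.trunc'_nonneg hyΛ hl)]
    refine (sum_le_sum hpt).trans ?_
    refine (sum_le_sum_of_subset_of_nonneg sdiff_subset fun y hy _ =>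
      mul_nonneg H.M_pos.le (add_nonneg (H.trunc'_nonneg hy hu) (H.trunc'_nonneg hy hl))).trans ?_
    rw [← mul_sum, sum_add_distrib]
    have su := H.sum_trunc'_le hu; have sl := H.sum_trunc'_le hl
    have hf0 := H.field_pos
    calc M * (∑ y ∈ Λ, (thetaCorr G Λ θ' ({y} ∆ {u}) - thetaCorr G Λ θ' {y} * thetaCorr G Λ θ' {u}) +
          ∑ y ∈ Λ, (thetaCorr G Λ θ' ({y} ∆ {l}) - thetaCorr G Λ θ' {y} * thetaCorr G Λ θ' {l}))
        ≤ M * (M / hf + M / hf) := mul_le_mul_of_nonneg_left (add_le_add su sl) H.M_pos.le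
      _ = 2 * (M ^ 2 / hf) := by field_simp; ring
  -- the three special sites
  have hvu : v ∉ ({l} : Finset V) := by simp [hvl]
  have huvl : u ∉ ({v, l} : Finset V) := by simp [huv, hul]
  rw [sum_insert huvl, sum_insert hvu, sum_singleton]
  have h1 : tripleTrunc G Λ θ' u ({u} ∆ {v}) ({v} ∆ {l}) ≤ M := (tripleTrunc_adj_end_le hθ' hu hv hl).trans (H.mag'_le hl)
  have h3 : tripleTrunc G Λ θ' l ({u} ∆ {v}) ({v} ∆ {l}) ≤ M := by
    rw [tripleTrunc_comm, symmDiff_comm ({v} : Finset V) {l}, symmDiff_comm ({u} : Finset V) {v}]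
    exact (tripleTrunc_adj_end_le hθ' hl hv hu).trans (H.mag'_le hu)
  have h2 : tripleTrunc G Λ θ' v ({u} ∆ {v}) ({v} ∆ {l}) ≤ 2 * M := by
    refine (tripleTrunc_adj_mid_le hθ' hu hv hl).trans ((thetaCorr_triple_sub_mul_le_trunc hθ' hv hu hl hul).trans ?_)
    have a1 : thetaCorr G Λ θ' ({v} ∆ {u}) - thetaCorr G Λ θ' {v} * thetaCorr G Λ θ' {u} ≤ 1 := by
      linarith [thetaCorr_le_one (G := G) (Λ := Λ) θ' ({v} ∆ {u}), mul_nonneg (H.mag'_nonneg hv) (H.mag'_nonneg hu)]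
    have a2 : thetaCorr G Λ θ' ({v} ∆ {l}) - thetaCorr G Λ θ' {v} * thetaCorr G Λ θ' {l} ≤ 1 := by
      linarith [thetaCorr_le_one (G := G) (Λ := Λ) θ' ({v} ∆ {l}), mul_nonneg (H.mag'_nonneg hv) (H.mag'_nonneg hl)]
    nlinarith [mul_le_mul (H.mag'_le hl) a1 (H.trunc'_nonneg hv hu) H.M_pos.le,
      mul_le_mul (H.mag'_le hu) a2 (H.trunc'_nonneg hv hl) H.M_pos.le]
  have hMM := H.M_le
  linarith [hgen, h1, h2, h3, hMM]

/-- **The summed Proposition 5.2** (Aizenman–Fernández 1986, Prop. 5.2 as used in (5.50)–(5.51)): for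
two distinct bonds `{u,v} ≠ {k,l}` of `Λ` in the dominated setting,
`∑_{y ∈ Λ} ⟨σ_y; σ_uσ_v; σ_kσ_l⟩_{θ'} ≤ 10 (M²/h̃) ∑_{w ∈ {u,v}} ∑_{w' ∈ {k,l}} ⟨σ_wσ_{w'}⟩_{θ,h=0}`. [cite: AizenmanFernandezJSP1986, §5.1, Prop. 5.2, and §5.3, eqs. (5.50)–(5.51)] -/
theorem sum_tripleTrunc_le {u v k l : V} (hu : u ∈ Λ) (hv : v ∈ Λ) (hk : k ∈ Λ) (hl : l ∈ Λ)
    (huv : u ≠ v) (hkl : k ≠ l) (hne : ({u, v} : Finset V) ≠ {k, l}) :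
    ∑ y ∈ Λ, tripleTrunc G Λ θ' y ({u} ∆ {v}) ({k} ∆ {l}) ≤
      10 * (M ^ 2 / hf) * ∑ w ∈ ({u, v} : Finset V), ∑ w' ∈ ({k, l} : Finset V), thetaCorr G Λ (zeroField θ) ({w} ∆ {w'}) := by
  have hθ' := H.nonneg'
  have hGsym : ∀ p q : V, thetaCorr G Λ (zeroField θ) ({p} ∆ {q}) = thetaCorr G Λ (zeroField θ) ({q} ∆ {p}) :=
    fun p q => by rw [symmDiff_comm]
  have hsum : ∑ w ∈ ({u, v} : Finset V), ∑ w' ∈ ({k, l} : Finset V), thetaCorr G Λ (zeroField θ) ({w} ∆ {w'}) =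
      thetaCorr G Λ (zeroField θ) ({u} ∆ {k}) + thetaCorr G Λ (zeroField θ) ({u} ∆ {l}) +
        thetaCorr G Λ (zeroField θ) ({v} ∆ {k}) + thetaCorr G Λ (zeroField θ) ({v} ∆ {l}) := by
    rw [sum_pair huv, sum_pair hkl, sum_pair hkl]; ring
  rw [hsum]
  have hc : 0 ≤ 10 * (M ^ 2 / hf) := by have := H.M_pos; have := H.field_pos; positivity
  have g1 := H.G_nonneg hu hk; have g2 := H.G_nonneg hu hl; have g3 := H.G_nonneg hv hk; have g4 := H.G_nonneg hv hl
  have hG1 : ∀ p : V, thetaCorr G Λ (zeroField θ) ({p} ∆ {p}) = 1 := fun p => by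
    rw [symmDiff_self, Finset.bot_eq_empty]; exact thetaCorr_empty _
  by_cases hdis : u ≠ k ∧ u ≠ l ∧ v ≠ k ∧ v ≠ l
  · obtain ⟨huk, hul, hvk, hvl⟩ := hdis
    have hS : ({u, v, k, l} : Finset V) ⊆ Λ := by
      intro w hw; simp only [mem_insert, mem_singleton] at hw
      rcases hw with rfl | rfl | rfl | rfl <;> assumption
    rw [← sum_sdiff hS]
    have hA := sum_tripleTrunc_sdiff_le H hu hv hk hl huv huk hul hvk hvl hkl
    have hB := tripleTrunc_four_le H hu hv hk hl huv hkl
    have e4 : ∑ y ∈ ({u, v, k, l} : Finset V), tripleTrunc G Λ θ' y ({u} ∆ {v}) ({k} ∆ {l}) =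
        tripleTrunc G Λ θ' u ({u} ∆ {v}) ({k} ∆ {l}) + tripleTrunc G Λ θ' v ({u} ∆ {v}) ({k} ∆ {l}) +
          tripleTrunc G Λ θ' k ({u} ∆ {v}) ({k} ∆ {l}) + tripleTrunc G Λ θ' l ({u} ∆ {v}) ({k} ∆ {l}) := by
      rw [sum_insert (by simp [huv, huk, hul]), sum_insert (by simp [hvk, hvl]), sum_pair hkl]; ring
    rw [e4]
    have hMM := H.M_le
    nlinarith [hA, hB, mul_le_mul_of_nonneg_right hMM (show 0 ≤ thetaCorr G Λ (zeroField θ) ({u} ∆ {k}) +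
      thetaCorr G Λ (zeroField θ) ({u} ∆ {l}) + thetaCorr G Λ (zeroField θ) ({v} ∆ {k}) + thetaCorr G Λ (zeroField θ) ({v} ∆ {l}) by positivity)]
  · -- the bonds share a vertex
    have hRHS : 10 * (M ^ 2 / hf) * 1 ≤ 10 * (M ^ 2 / hf) * (thetaCorr G Λ (zeroField θ) ({u} ∆ {k}) +
        thetaCorr G Λ (zeroField θ) ({u} ∆ {l}) + thetaCorr G Λ (zeroField θ) ({v} ∆ {k}) + thetaCorr G Λ (zeroField θ) ({v} ∆ {l})) →
        ∑ y ∈ Λ, tripleTrunc G Λ θ' y ({u} ∆ {v}) ({k} ∆ {l}) ≤ 10 * (M ^ 2 / hf) →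
        ∑ y ∈ Λ, tripleTrunc G Λ θ' y ({u} ∆ {v}) ({k} ∆ {l}) ≤ 10 * (M ^ 2 / hf) * (thetaCorr G Λ (zeroField θ) ({u} ∆ {k}) +
          thetaCorr G Λ (zeroField θ) ({u} ∆ {l}) + thetaCorr G Λ (zeroField θ) ({v} ∆ {k}) + thetaCorr G Λ (zeroField θ) ({v} ∆ {l})) :=
      fun h1 h2 => h2.trans (by rw [mul_one] at h1; exact h1)
    simp only [not_and_or, not_not] at hdis
    rcases hdis with rfl | rfl | rfl | rfl
    · -- `u = k`: bonds `{v,u}`, `{u,l}`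
      have hvl : v ≠ l := fun h => hne (by rw [h])
      refine hRHS (mul_le_mul_of_nonneg_left (by rw [hG1]; linarith) hc) ?_
      rw [symmDiff_comm ({u} : Finset V) {v}]
      exact sum_tripleTrunc_adj_le H hv hu hl (Ne.symm huv) hkl hvl
    · -- `u = l`: bonds `{v,u}`, `{u,k}`
      have hvk : v ≠ k := fun h => hne (by rw [h, pair_comm])
      refine hRHS (mul_le_mul_of_nonneg_left (by rw [hG1]; linarith) hc) ?_
      rw [symmDiff_comm ({u} : Finset V) {v}, symmDiff_comm ({k} : Finset V) {u}]
      exact sum_tripleTrunc_adj_le H hv hu hk (Ne.symm huv) (Ne.symm hkl) hvk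
    · -- `v = k`: bonds `{u,v}`, `{v,l}`
      have hul : u ≠ l := fun h => hne (by rw [h, pair_comm])
      refine hRHS (mul_le_mul_of_nonneg_left (by rw [hG1]; linarith) hc) ?_
      exact sum_tripleTrunc_adj_le H hu hv hl huv hkl hul
    · -- `v = l`: bonds `{u,v}`, `{v,k}`
      have huk : u ≠ k := fun h => hne (by rw [h])
      refine hRHS (mul_le_mul_of_nonneg_left (by rw [hG1]; linarith) hc) ?_
      rw [symmDiff_comm ({k} : Finset V) {v}]
      exact sum_tripleTrunc_adj_le H hu hv hk huv (Ne.symm hkl) huk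

end Sums

end Summed

end Literature.Probability.LatticeModels
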